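import Mathlib
import Literature.AlgebraicGeometry.Resolution.PowerSeriesCleaning

/-!
# `WeightedInvariant.WeightedConstruction`, line `weighted-oblique-fuel`: the `pᵉ`-th-root splitting

Route `ResolutionOfSingularities/WeightedInvariant`, crux `WeightedConstruction`
(stmt-ResolutionOfSingularities-0571), stub `stub_cleanSplit` of the lead's skeleton
`work/WeightedConstruction.lean`, PROVED here (statement verbatim from the ledger registration).

**Statement (CLEAN SPLIT).** Let `p` be a prime, `k` a perfect field of characteristic `p`,
`q = pᵉ`, and `H ∈ k[[x₁, …, xₘ]]`.  Then there is `R ∈ k[[x]]` with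
`H = qClean q H + R^q`, and `R` has zero constant term whenever `H` does.  Here `qClean q H`
(tree module `Literature.AlgebraicGeometry.Resolution.PowerSeriesCleaning`) deletes from `H` every
monomial `c·x^α` with `q ∣ αₗ` for all `l`; over a perfect field these are exactly the `q`-th
powers, and this splitting is what makes Hauser–Perlega *cleaning* (`z ↦ z + R` in the purely
inseparable equation `z^q + H(x) = 0`) possible.  The degenerate cases `e = 0` (`q = 1`,
`qClean 1 H = 0`, `R = H`) and `m = 0` are covered uniformly.

**Proof.** Put `R := Σ_β (a_{q•β})^{1/q} x^β`, i.e. coefficientwise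
`coeff β R = (iterateFrobeniusEquiv k p e)⁻¹ (coeff (q • β) H)` (the `q`-th root exists and is
unique because `k` is perfect: `PerfectField k` and `ExpChar k p` give `PerfectRing k p`).  By
Mathlib's `MvPowerSeries.map_iterateFrobenius_expand`,
`R^q = map (iterateFrobenius k p e) (expand q R)`, so `coeff γ (R^q)` is `(coeff β R)^q = a_γ` when
`γ = q • β` (`coeff_expand_smul`) and `0` when some `γₗ` is not divisible by `q`
(`coeff_expand_of_not_dvd`).  Comparing with `coeff_qClean_of_dvd` / `coeff_qClean_of_not_dvd`
gives `H = qClean q H + R^q` coefficientwise, and `coeff 0 R = (a₀)^{1/q}` vanishes with `a₀`.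
-/

set_option linter.dupNamespace false -- mandated namespace of this single-conjunct summit

namespace Summit.ResolutionOfSingularities.ResolutionOfSingularities.Theorems

open Literature.AlgebraicGeometry.Resolution

/-- CLEAN SPLIT (`pᵉ`-th-root splitting over a perfect field): every `H ∈ k[[x₁, …, xₘ]]` is
`qClean (p^e) H + R^(p^e)` for some `R`, whose constant term vanishes when that of `H` does. -/
theorem stub_cleanSplit : ∀ (p : ℕ), p.Prime → ∀ (k : Type) [Field k] [CharP k p] [PerfectField k] (e m : ℕ) (H : MvPowerSeries (Fin m) k), ∃ R : MvPowerSeries (Fin m) k, H = qClean (p ^ e) H + R ^ (p ^ e) ∧ (MvPowerSeries.constantCoeff H = 0 → MvPowerSeries.constantCoeff R = 0) := by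
  intro p hp k _ _ _ e m H
  classical
  haveI : ExpChar k p := ExpChar.prime hp
  have hp0 : p ≠ 0 := hp.ne_zero
  -- The `q`-th root of the `q`-th-power part of `H`, defined coefficientwise.
  let R : MvPowerSeries (Fin m) k := fun β =>
    (iterateFrobeniusEquiv k p e).symm (MvPowerSeries.coeff ((p ^ e) • β) H)
  have hR : ∀ β, MvPowerSeries.coeff β R =
      (iterateFrobeniusEquiv k p e).symm (MvPowerSeries.coeff ((p ^ e) • β) H) := fun β =>
    MvPowerSeries.coeff_apply R β
  have hRq : R ^ (p ^ e) = MvPowerSeries.map (iterateFrobenius k p e)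
      (MvPowerSeries.expand (p ^ e) (pow_ne_zero e hp0) R) :=
    (MvPowerSeries.map_iterateFrobenius_expand p hp0 R e).symm
  refine ⟨R, ?_, ?_⟩
  · ext γ
    rw [map_add, hRq, MvPowerSeries.coeff_map]
    by_cases hγ : ∀ l, p ^ e ∣ γ l
    · obtain ⟨β, rfl⟩ : ∃ β, (p ^ e) • β = γ :=
        ⟨γ.mapRange (fun a => a / p ^ e) (by simp), by
          ext i
          simp [Nat.mul_div_cancel' (hγ i)]⟩
      rw [coeff_qClean_of_dvd _ _ hγ, zero_add, MvPowerSeries.coeff_expand_smul, hR,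
        ← coe_iterateFrobeniusEquiv, RingEquiv.apply_symm_apply]
    · obtain ⟨i, hi⟩ := not_forall.mp hγ
      rw [coeff_qClean_of_not_dvd _ _ hγ, MvPowerSeries.coeff_expand_of_not_dvd _ _ _ hi,
        map_zero, add_zero]
  · intro hH
    rw [← MvPowerSeries.coeff_zero_eq_constantCoeff_apply, hR, smul_zero,
      MvPowerSeries.coeff_zero_eq_constantCoeff_apply, hH, map_zero]

end Summit.ResolutionOfSingularities.ResolutionOfSingularities.Theorems
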